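import Summits.NavierStokesRegularity.NavierStokesRegularity.Theorems.PerpetualPumpAveragedTypeIBlowupOneStepCoreTools
import Summits.NavierStokesRegularity.NavierStokesRegularity.Theorems.PerpetualPumpAveragedTypeIBlowupIncubationTools
import Mathlib.Analysis.SpecialFunctions.Pow.Real
import Mathlib.Analysis.Complex.ExponentialBounds
import Mathlib.Order.Filter.Finite

/-!
# Crux `PerpetualPump.AveragedTypeIBlowup` (stmt-NavierStokesRegularity-1835), line `Sketch`:
# stub `preBoot` — rates, real induction and regime numerics

Second tools file of the proof of the registered stub `stub_preBoot` (the pre-ignition bootstrap of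
the window one-step theorem; Mathlib-only mathematics): the relative rates of the cascade
(`preBoot_rates`), the inflow algebra `w_{k−1}/q^{3/2}` (`preBoot_divsq`, `preBoot_div_q`), a
real-induction principle on `[a, b]` and the passage from eventual to uniform statements
(`preBoot_induction`, `preBoot_eventually_delta`, `preBoot_eventually_lt`), and the numerics of
the regime (`preBoot_exp_three`, `preBoot_exp_six`, `preBoot_exp_eight`, `preBoot_pow19` = the
registered tools sub-goal `stub_preBootRegime`, `preBoot_eta`, `preBoot_Lambda`).

## References

T. Tao, *Finite time blowup for an averaged three-dimensional Navier–Stokes equation*, J. Amer.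
Math. Soc. 29 (2016), §5–6 (the cascade heuristics); the content here is folklore calculus.
-/

noncomputable section

-- the summit namespace `…NavierStokesRegularity.NavierStokesRegularity…` is the tree convention
set_option linter.dupNamespace false

open Set MeasureTheory Filter Topology

namespace Summit.NavierStokesRegularity.NavierStokesRegularity.Theorems.PerpetualPumpAveragedTypeIBlowup

/-- **Relative rates of the cascade** `R k = D (1+ε₀)^{2k}`: positivity, `R_{n-1}/R_n = (1+ε₀)⁻²
∈ [4/5, 1]`, `R_{n+1}/R_n = q⁴` (`q = √(1+ε₀)`), `R_{n+j}/R_n = (1+ε₀)^{2j} ≥ 1`. [folklore] -/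
theorem preBoot_rates {ε₀ D q : ℝ} {R : ℤ → ℝ} (hε₀ : 0 < ε₀) (hε₀' : ε₀ ≤ 1 / 20) (hD : 0 < D)
    (hR : ∀ k : ℤ, R k = D * (1 + ε₀) ^ (2 * k)) (hq : q = Real.sqrt (1 + ε₀)) (n : ℤ) :
    (∀ k : ℤ, 0 < R k) ∧ (∀ k : ℤ, R k / R k = 1) ∧ R (n - 1) / R n = (1 + ε₀) ^ (-(2 : ℤ)) ∧
    R (n + 1) / R n = q ^ 4 ∧ (∀ j : ℕ, R (n + j) / R n = (1 + ε₀) ^ (2 * j)) ∧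
    (∀ j : ℕ, 1 ≤ R (n + j) / R n) ∧ 4 / 5 ≤ (1 + ε₀) ^ (-(2 : ℤ)) ∧ (1 + ε₀) ^ (-(2 : ℤ)) ≤ 1 ∧
    (1 + ε₀) ^ (-(2 : ℤ)) * q ^ 4 = 1 ∧ 0 < q ∧ q ^ 2 = 1 + ε₀ := by
  have ha : (0 : ℝ) < 1 + ε₀ := by linarith
  have ha1 : (1 : ℝ) ≤ 1 + ε₀ := by linarith
  have hpos : ∀ k : ℤ, 0 < R k := fun k => by
    rw [hR]
    exact mul_pos hD (zpow_pos ha _)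
  have key : ∀ m : ℤ, R m / R n = (1 + ε₀) ^ (2 * m - 2 * n) := by
    intro m
    rw [hR, hR, zpow_sub₀ ha.ne', mul_div_mul_left _ _ hD.ne']
  have hq2 : q ^ 2 = 1 + ε₀ := by
    rw [hq, Real.sq_sqrt ha.le]
  have hq0 : 0 < q := by
    rw [hq]
    exact Real.sqrt_pos.2 ha
  have hm2 : (1 + ε₀) ^ (-(2 : ℤ)) = ((1 + ε₀) ^ 2)⁻¹ := by
    rw [zpow_neg, zpow_ofNat]
  have hsq : (1 + ε₀) ^ 2 ≤ 5 / 4 := by nlinarith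
  refine ⟨hpos, fun k => div_self (hpos k).ne', ?_, ?_, fun j => ?_, fun j => ?_, ?_, ?_, ?_, hq0, hq2⟩
  · rw [key]
    congr 1
    ring
  · rw [key, show (2 * (n + 1) - 2 * n : ℤ) = ((2 : ℕ) : ℤ) by ring, zpow_natCast,
      show q ^ 4 = (q ^ 2) ^ 2 by ring, hq2]
  · rw [key, show (2 * (n + (j : ℤ)) - 2 * n : ℤ) = ((2 * j : ℕ) : ℤ) by push_cast; ring,
      zpow_natCast]
  · rw [key, show (2 * (n + (j : ℤ)) - 2 * n : ℤ) = ((2 * j : ℕ) : ℤ) by push_cast; ring,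
      zpow_natCast]
    exact one_le_pow₀ ha1
  · rw [hm2, le_inv_comm₀ (by norm_num) (by positivity)]
    linarith
  · rw [hm2]
    exact inv_le_one_of_one_le₀ (by nlinarith)
  · rw [hm2, show q ^ 4 = (q ^ 2) ^ 2 by ring, hq2]
    exact inv_mul_cancel₀ (by positivity)

/-- `(a/(q√q))² = a²/q³` and `|a/(q√q)| ≤ |a|` for `q ≥ 1`: the inflow `wl = w_{k-1}/q^{3/2}` of the
phase lemmas. [folklore] -/
theorem preBoot_divsq {q : ℝ} (hq : 1 ≤ q) (a : ℝ) :
    (a / (q * Real.sqrt q)) ^ 2 = a ^ 2 / q ^ 3 ∧ |a / (q * Real.sqrt q)| ≤ |a| := by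
  have hq0 : 0 ≤ q := le_trans zero_le_one hq
  have h1 : 1 ≤ q * Real.sqrt q := one_le_mul_of_one_le_of_one_le hq (Real.one_le_sqrt.2 hq)
  refine ⟨?_, ?_⟩
  · rw [div_pow, mul_pow, Real.sq_sqrt hq0]
    ring
  · rw [abs_div, abs_of_pos (lt_of_lt_of_le zero_lt_one h1)]
    exact div_le_self (abs_nonneg a) h1

/-- `x ∈ [−1/2, 9/10] ⇒ x/q ∈ [−1/2, 9/10]` and `|x| ≤ c ⇒ |x/q| ≤ c` for `q ≥ 1`. [folklore] -/
theorem preBoot_div_q {q : ℝ} (hq : 1 ≤ q) :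
    (∀ x : ℝ, -(1 / 2) ≤ x → x ≤ 9 / 10 → -(1 / 2) ≤ x / q ∧ x / q ≤ 9 / 10) ∧
    (∀ x c : ℝ, |x| ≤ c → |x / q| ≤ c) := by
  have hq0 : 0 < q := by linarith
  refine ⟨fun x h1 h2 => ⟨?_, ?_⟩, fun x c h => ?_⟩
  · rw [le_div_iff₀ hq0]
    nlinarith
  · rw [div_le_iff₀ hq0]
    nlinarith
  · rw [abs_div, abs_of_pos hq0]
    exact (div_le_self (abs_nonneg x) hq).trans h

/-- **Real induction on `[a, b]`** (shift of `incubation_induction`): a predicate holding at `a`,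
closed under limits from the left and extending a little to the right of every good initial
segment, holds on `[a, b]`. [folklore] -/
theorem preBoot_induction {P : ℝ → Prop} {a b : ℝ} (hab : a ≤ b) (h0 : P a)
    (hclosed : ∀ t ∈ Ioc a b, (∀ u ∈ Ico a t, P u) → P t)
    (hopen : ∀ t ∈ Ico a b, (∀ u ∈ Icc a t, P u) →
      ∃ δ : ℝ, 0 < δ ∧ ∀ u ∈ Ioc t (t + δ), u ≤ b → P u) :
    ∀ u ∈ Icc a b, P u := by
  have ha0 : P (a + 0) := by rwa [add_zero]
  have h := incubation_induction (P := fun v => P (a + v)) (τ := b - a) (sub_nonneg.2 hab) ha0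
    ?_ ?_
  · intro u hu
    have := h (u - a) ⟨by linarith [hu.1], by linarith [hu.2]⟩
    rwa [show a + (u - a) = u by ring] at this
  · intro T hT hP
    exact hclosed (a + T) ⟨by linarith [hT.1], by linarith [hT.2]⟩ fun u hu => by
      have := hP (u - a) ⟨by linarith [hu.1], by linarith [hu.2]⟩
      rwa [show a + (u - a) = u by ring] at this
  · intro T hT hP
    obtain ⟨δ, hδ, h'⟩ := hopen (a + T) ⟨by linarith [hT.1], by linarith [hT.2]⟩ fun u hu => by
      have := hP (u - a) ⟨by linarith [hu.1], by linarith [hu.2]⟩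
      rwa [show a + (u - a) = u by ring] at this
    exact ⟨δ, hδ, fun u hu hub => h' (a + u) ⟨by linarith [hu.1], by linarith [hu.2]⟩ (by linarith)⟩

/-- **From an eventual to a uniform statement to the right**: if `P` holds eventually in
`𝓝[[a, b]] t` (`t ∈ [a, b)`), then on some `(t, t + δ] ∩ (−∞, b]`. [folklore] -/
theorem preBoot_eventually_delta {P : ℝ → Prop} {a b t : ℝ} (h : ∀ᶠ u in 𝓝[Icc a b] t, P u)
    (ht : t ∈ Ico a b) : ∃ δ : ℝ, 0 < δ ∧ ∀ u ∈ Ioc t (t + δ), u ≤ b → P u := by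
  obtain ⟨ε, hε, hball⟩ := Metric.mem_nhdsWithin_iff.1 h
  refine ⟨ε / 2, half_pos hε, fun u hu hub => hball ⟨?_, ht.1.trans hu.1.le, hub⟩⟩
  rw [Metric.mem_ball, Real.dist_eq, abs_of_nonneg (by linarith [hu.1])]
  linarith [hu.2]

/-- **Strict inequalities persist**: `f t < g t` with `f, g` continuous within `s` at `t` gives
`f < g` eventually in `𝓝[s] t`. [folklore] -/
theorem preBoot_eventually_lt {f g : ℝ → ℝ} {s : Set ℝ} {t : ℝ} (hf : ContinuousWithinAt f s t)
    (hg : ContinuousWithinAt g s t) (h : f t < g t) : ∀ᶠ u in 𝓝[s] t, f u < g u :=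
  Filter.Tendsto.eventually_lt hf.tendsto hg.tendsto h

/-- `e³ < 21` (so `B e^{-σ} ≥ B/21` for `σ ≤ 3`). [folklore] -/
theorem preBoot_exp_three : Real.exp 3 < 21 := by
  have h1 : Real.exp 1 < 2.7182818286 := Real.exp_one_lt_d9
  have h0 : 0 < Real.exp 1 := Real.exp_pos 1
  have h3 : Real.exp 3 = Real.exp 1 ^ 3 := by rw [← Real.exp_nat_mul]; norm_num
  rw [h3]
  have h2 : Real.exp 1 ^ 2 < 2.7182818286 ^ 2 := by nlinarith
  nlinarith

/-- `e⁶ < 405` (so `η e^{2T} ≤ 10⁻³` for `T ≤ 3` in the regime). [folklore] -/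
theorem preBoot_exp_six : Real.exp 6 < 405 := by
  have h3 := preBoot_exp_three
  have h0 : 0 < Real.exp 3 := Real.exp_pos 3
  have h6 : Real.exp 6 = Real.exp 3 ^ 2 := by rw [← Real.exp_nat_mul]; norm_num
  have h3' : Real.exp 3 < 20.1 := by
    have h1 : Real.exp 1 < 2.7182818286 := Real.exp_one_lt_d9
    have h0' : 0 < Real.exp 1 := Real.exp_pos 1
    have h33 : Real.exp 3 = Real.exp 1 ^ 3 := by rw [← Real.exp_nat_mul]; norm_num
    rw [h33]
    have h2 : Real.exp 1 ^ 2 < 2.7182818286 ^ 2 := by nlinarith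
    nlinarith
  rw [h6]
  nlinarith

/-- `e⁸ > 1100` (so `11 e^{-26} ≤ 10⁻²`). [folklore] -/
theorem preBoot_exp_eight : 1100 < Real.exp 8 := by
  have h1 : 2.7182818283 < Real.exp 1 := Real.exp_one_gt_d9
  have h8 : Real.exp 8 = Real.exp 1 ^ 8 := by rw [← Real.exp_nat_mul]; norm_num
  rw [h8]
  have h2 : (2.7182818283 : ℝ) ^ 8 < Real.exp 1 ^ 8 := pow_lt_pow_left₀ h1 (by norm_num) (by norm_num)
  have h3 : (1100 : ℝ) < 2.7182818283 ^ 8 := by norm_num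
  linarith

/-- `(1+ε₀)^{19} ≤ 3` for `0 ≤ ε₀ ≤ 1/20` (adjacent rungs of the ladder profile differ by at most a
factor `3`). [folklore] -/
theorem preBoot_pow19 {ε₀ : ℝ} (hε₀ : 0 ≤ ε₀) (hε₀' : ε₀ ≤ 1 / 20) : (1 + ε₀) ^ 19 ≤ 3 := by
  have h1 : (1 + ε₀) ^ 19 ≤ (21 / 20 : ℝ) ^ 19 :=
    pow_le_pow_left₀ (by linarith) (by linarith) 19
  have h2 : (21 / 20 : ℝ) ^ 19 ≤ 3 := by norm_num
  linarith

/-- **The memory coefficient is negligible**: from `η·10⁹(b_hi+4)⁴(F+1) ≤ 1`, `b_hi + 4 ≥ 1`,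
`F ≥ 0`: `η ≤ 10⁻⁹`, `η(b_hi+4)ⁱ ≤ 10⁻⁹` (`i ≤ 4`), `η(b_hi+4)³(F+1) ≤ 10⁻⁹`. [folklore] -/
theorem preBoot_eta {η F bhi : ℝ} (hη : 0 ≤ η) (hF : 0 ≤ F) (hbhi : 1 ≤ bhi + 4)
    (hreg : η * (10 ^ 9 * (bhi + 4) ^ 4 * (F + 1)) ≤ 1) :
    η ≤ 1 / 10 ^ 9 ∧ η * (bhi + 4) ≤ 1 / 10 ^ 9 ∧ η * (bhi + 4) ^ 2 ≤ 1 / 10 ^ 9 ∧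
    η * (bhi + 4) ^ 4 ≤ 1 / 10 ^ 9 ∧ η * ((bhi + 4) ^ 3 * (F + 1)) ≤ 1 / 10 ^ 9 ∧
    η * ((bhi + 4) ^ 4 * (F + 1)) ≤ 1 / 10 ^ 9 := by
  have hX : η * ((bhi + 4) ^ 4 * (F + 1)) ≤ 1 / 10 ^ 9 := by
    rw [le_div_iff₀ (by norm_num)]
    nlinarith
  have hF1 : 1 ≤ F + 1 := by linarith
  have hp : ∀ i : ℕ, 1 ≤ (bhi + 4) ^ i := fun i => one_le_pow₀ hbhi
  have hmono : ∀ c : ℝ, 0 ≤ c → c ≤ (bhi + 4) ^ 4 * (F + 1) → η * c ≤ 1 / 10 ^ 9 :=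
    fun c _ hc => le_trans (mul_le_mul_of_nonneg_left hc hη) hX
  have h44 : (bhi + 4) ^ 4 ≤ (bhi + 4) ^ 4 * (F + 1) := le_mul_of_one_le_right (by positivity) hF1
  refine ⟨?_, hmono _ (by positivity) ?_, hmono _ (by positivity) ?_, hmono _ (by positivity) h44,
    hmono _ (by positivity) ?_, hX⟩
  · have := hmono 1 zero_le_one (le_trans (hp 4) h44)
    simpa using this
  · exact le_trans (by nlinarith [hp 3] : bhi + 4 ≤ (bhi + 4) ^ 4) h44
  · exact le_trans (by nlinarith [hp 2] : (bhi + 4) ^ 2 ≤ (bhi + 4) ^ 4) h44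
  · exact mul_le_mul_of_nonneg_right (by nlinarith [hp 3]) (by linarith)

/-- **The dump scale `Λ₀ = 100 + 4 log(b_hi + 5)` and the relaxation time `σ_I = 2Λ₀/B`** in the
regime (`ε̄ ≤ 1`, `B ≥ 10⁴ + 40 − 5 log ε̄`, `−log ε̄ ≥ 10³ + 20 log(b_hi+5) + log(F+2)`, `B ≤ b_hi`):
`100 ≤ Λ₀`, `25 Λ₀ ≤ B`, `0 < σ_I ≤ 2/25`, `Λ₀ ≤ B(1 − e^{−σ_I})`, and the decay certificate
`11 √B e^{−κΛ₀/3} ≤ 1/100` for `κ ≥ 4/5`. [folklore] -/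
theorem preBoot_Lambda {εb F blo bhi B κ : ℝ} (hεb : 0 < εb) (hεb1 : εb ≤ 1) (hF : 0 ≤ F)
    (hblo : 10 ^ 4 + 40 - 5 * Real.log εb ≤ blo)
    (hreg : 10 ^ 3 + 20 * Real.log (bhi + 5) + Real.log (F + 2) ≤ -Real.log εb)
    (hBlo : blo ≤ B) (hBhi : B ≤ bhi) (hκ : 4 / 5 ≤ κ) :
    100 ≤ 100 + 4 * Real.log (bhi + 5) ∧ 25 * (100 + 4 * Real.log (bhi + 5)) ≤ B ∧
    0 < 2 * (100 + 4 * Real.log (bhi + 5)) / B ∧ 2 * (100 + 4 * Real.log (bhi + 5)) / B ≤ 2 / 25 ∧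
    100 + 4 * Real.log (bhi + 5) ≤ B * (1 - Real.exp (-(2 * (100 + 4 * Real.log (bhi + 5)) / B))) ∧
    11 * Real.sqrt B * Real.exp (-(κ * (100 + 4 * Real.log (bhi + 5)) / 3)) ≤ 1 / 100 := by
  have hlogε : Real.log εb ≤ 0 := Real.log_nonpos hεb.le hεb1
  have hB4 : 10 ^ 4 ≤ B := by linarith
  have hB0 : 0 < B := by linarith
  have hlog5 : 0 ≤ Real.log (bhi + 5) := Real.log_nonneg (by linarith)
  have hlogF : 0 ≤ Real.log (F + 2) := Real.log_nonneg (by linarith)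
  set Λ := 100 + 4 * Real.log (bhi + 5) with hΛ
  have hΛ100 : 100 ≤ Λ := by rw [hΛ]; linarith
  have h25 : 25 * Λ ≤ B := by rw [hΛ]; linarith
  have hσpos : 0 < 2 * Λ / B := div_pos (by linarith) hB0
  have hσle : 2 * Λ / B ≤ 2 / 25 := by
    rw [div_le_div_iff₀ hB0 (by norm_num)]
    linarith
  refine ⟨hΛ100, h25, hσpos, hσle, ?_, ?_⟩
  · -- `1 - e^{-x} ≥ x/2` on `[0, 1]` (`e^{-x} ≤ 1/(1+x) ≤ 1 - x/2`)
    set x := 2 * Λ / B with hx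
    have hx1 : x ≤ 1 := hσle.trans (by norm_num)
    have hexp : Real.exp (-x) ≤ 1 - x / 2 := by
      have h1 : 1 + x ≤ Real.exp x := by
        have := Real.add_one_le_exp x
        linarith
      have h2 : Real.exp (-x) * Real.exp x = 1 := by
        rw [← Real.exp_add]
        simp
      have h3 : Real.exp (-x) ≤ 1 / (1 + x) := by
        rw [le_div_iff₀ (by linarith)]
        nlinarith [Real.exp_pos (-x)]
      have h4 : 1 / (1 + x) ≤ 1 - x / 2 := by
        rw [div_le_iff₀ (by linarith)]
        nlinarith
      linarith
    have hBx : B * (x / 2) = Λ := by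
      rw [hx]
      field_simp
    nlinarith
  · -- `κΛ/3 ≥ 26 + log(bhi+5)`, `e^{-26} ≤ e^{-8} ≤ 1/1100`, `√B ≤ B ≤ bhi + 5`
    have hexp1 : κ * Λ / 3 ≥ 26 + Real.log (bhi + 5) := by
      rw [hΛ, ge_iff_le, le_div_iff₀ (by norm_num)]
      nlinarith
    have hE : Real.exp (-(κ * Λ / 3)) ≤ Real.exp (-26) * (bhi + 5)⁻¹ := by
      have h1 : Real.exp (-(κ * Λ / 3)) ≤ Real.exp (-(26 + Real.log (bhi + 5))) :=
        Real.exp_le_exp.2 (by linarith)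
      rw [neg_add, Real.exp_add, Real.exp_neg (Real.log (bhi + 5)),
        Real.exp_log (by linarith)] at h1
      exact h1
    have h26 : Real.exp (-26) ≤ 1 / 1100 := by
      have h8 := preBoot_exp_eight
      have hle : Real.exp (-26) ≤ Real.exp (-8) := Real.exp_le_exp.2 (by norm_num)
      have h8' : Real.exp (-8) ≤ 1 / 1100 := by
        rw [Real.exp_neg, inv_le_comm₀ (Real.exp_pos 8) (by norm_num)]
        rw [one_div, inv_inv]
        exact h8.le
      exact hle.trans h8'
    have hsqrt : Real.sqrt B ≤ bhi + 5 := by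
      rw [Real.sqrt_le_left (by linarith)]
      nlinarith
    have hsq0 : 0 ≤ Real.sqrt B := Real.sqrt_nonneg B
    have hb5 : 0 < bhi + 5 := by linarith
    calc 11 * Real.sqrt B * Real.exp (-(κ * Λ / 3))
        ≤ 11 * Real.sqrt B * (Real.exp (-26) * (bhi + 5)⁻¹) :=
          mul_le_mul_of_nonneg_left hE (by positivity)
      _ = 11 * Real.exp (-26) * (Real.sqrt B / (bhi + 5)) := by ring
      _ ≤ 11 * (1 / 1100) * 1 := by
          apply mul_le_mul (by linarith [Real.exp_pos (-26)]) ((div_le_one hb5).2 hsqrt)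
            (by positivity) (by positivity)
      _ = 1 / 100 := by norm_num

/-- **Registered tools sub-goal `stub_preBootRegime`** of the stub `preBoot` (line `Sketch`, crux
stmt-NavierStokesRegularity-1835): adjacent rungs of the ladder profile differ by at most a factor
`3`, `(1+ε₀)^{19} ≤ 3` for `0 ≤ ε₀ ≤ 1/20` (`preBoot_pow19`). [folklore] -/
theorem stub_preBootRegime : ∀ ε₀ : ℝ, 0 ≤ ε₀ → ε₀ ≤ 1 / 20 → (1 + ε₀) ^ 19 ≤ 3 :=
  fun _ h1 h2 => preBoot_pow19 h1 h2

end Summit.NavierStokesRegularity.NavierStokesRegularity.Theorems.PerpetualPumpAveragedTypeIBlowup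

end
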